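import Mathlib

/-!
# Skew-cut certificate: the Schur sums of a banded first-order matrix are automatic
(instab4 g4 — implementation 2 of the skew-cut X0 certifier, cell `ns-blowup`, 2026-08-26)

HONEST FRAMING (human ruling D-0035): nothing here is a claim about Navier–Stokes blow-up.
WHAT THIS IS NOT: not NS evidence. MODEL lane bookkeeping. The end-to-end statement
`SkewCutGalerkinFromSections.exists_smooth_eigenvector_Ioo_of_sections` asks for the Schur data of the
matrix `t_ij = A_ij d_j` of the relative bound (`Σ_j ‖t_ij‖ ≤ R₀`, `Σ_i ‖t_ij‖ ≤ C₀`, `R₀ C₀ < 1`). For a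
matrix supported on a symmetric band of width `≤ W` these sums are FINITE and bounded by `W` times an
entry bound (`schur_sums_of_band`); and for the standard resolvent symbol `d_i = (x₀ − ℓ_i)⁻¹` and
weights `w_i = √(1 + |ℓ_i|)` of a non-positive diagonal part, the first-order growth `‖A_ij‖ ≤ K w_j`
gives the entry bound `‖t_ij‖ ≤ K w_j ‖d_j‖ ≤ K / (2√(x₀ − 1))` (`weight_mul_resolvent_le`, AM–GM), so
`R₀ = C₀ = W K / (2 √(x₀ − 1))` and `R₀ C₀ < 1` as soon as `x₀ > 1 + W²K²/4` (`schur_product_lt_one`): the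
base point `x₀` is free, and obligation (A2) of HOME/instab4/KERNEL-CHAIN.md reduces to the band and
the first-order growth of the exact entries.

Mathlib only; no new definitions.
-/

namespace Summit.NavierStokesRegularity.FluidComputer.SkewCutGalerkinSchurSums

open scoped BigOperators

variable {ι 𝕜 : Type*} [RCLike 𝕜]

/-- **Banded ⇒ Schur data.** If `t i j = 0` unless `j ∈ nbr i`, the band is symmetric with at most
`W` neighbours, and `‖t i j‖ ≤ B` on the band (`0 ≤ B`), then every row and column of `‖t‖` is
summable with sum `≤ W B`. -/
theorem schur_sums_of_band (t : ι → ι → 𝕜) (nbr : ι → Finset ι)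
    (hsymm : ∀ i j, j ∈ nbr i ↔ i ∈ nbr j) {W : ℕ} (hW : ∀ i, (nbr i).card ≤ W)
    (ht0 : ∀ i j, j ∉ nbr i → t i j = 0) {B : ℝ} (hB0 : 0 ≤ B)
    (hB : ∀ i j, j ∈ nbr i → ‖t i j‖ ≤ B) :
    (∀ i, Summable fun j => ‖t i j‖) ∧ (∀ i, ∑' j, ‖t i j‖ ≤ W * B) ∧
      (∀ j, Summable fun i => ‖t i j‖) ∧ (∀ j, ∑' i, ‖t i j‖ ≤ W * B) := by
  have hrow0 : ∀ i, ∀ j ∉ nbr i, ‖t i j‖ = 0 := fun i j hj => by rw [ht0 i j hj, norm_zero]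
  have hcol0 : ∀ j, ∀ i ∉ nbr j, ‖t i j‖ = 0 := fun j i hi => by
    rw [ht0 i j (fun h => hi ((hsymm i j).1 h)), norm_zero]
  have hrowS : ∀ i, Summable fun j => ‖t i j‖ := fun i => summable_of_ne_finset_zero (hrow0 i)
  have hcolS : ∀ j, Summable fun i => ‖t i j‖ := fun j => summable_of_ne_finset_zero (hcol0 j)
  have hbound : ∀ (s : Finset ι) (f : ι → ℝ), s.card ≤ W → (∀ k ∈ s, f k ≤ B) →
      ∑ k ∈ s, f k ≤ W * B := fun s f hs hf =>
    calc ∑ k ∈ s, f k ≤ ∑ _k ∈ s, B := Finset.sum_le_sum hf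
      _ = s.card * B := by rw [Finset.sum_const, nsmul_eq_mul]
      _ ≤ W * B := mul_le_mul_of_nonneg_right (by exact_mod_cast hs) hB0
  refine ⟨hrowS, fun i => ?_, hcolS, fun j => ?_⟩
  · rw [tsum_eq_sum (s := nbr i) (hrow0 i)]
    exact hbound (nbr i) (fun j => ‖t i j‖) (hW i) fun j hj => hB i j hj
  · rw [tsum_eq_sum (s := nbr j) (hcol0 j)]
    exact hbound (nbr j) (fun i => ‖t i j‖) (hW j) fun i hi => hB i j ((hsymm i j).2 hi)

/-- **AM–GM for the standard weights.** For `ℓ ≤ 0` and `x₀ > 1`: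
`√(1 + |ℓ|) / (x₀ − ℓ) ≤ 1 / (2 √(x₀ − 1))` (the product of the weight `w = √(1 + |ℓ|)` and the
resolvent symbol `d = (x₀ − ℓ)⁻¹`; maximal at `1 + |ℓ| = x₀ − 1`). -/
theorem weight_mul_resolvent_le {ℓ x₀ : ℝ} (hℓ : ℓ ≤ 0) (hx₀ : 1 < x₀) :
    Real.sqrt (1 + |ℓ|) * (x₀ - ℓ)⁻¹ ≤ 1 / (2 * Real.sqrt (x₀ - 1)) := by
  have hu : 0 ≤ 1 + |ℓ| := by positivity
  have hc : 0 < x₀ - 1 := by linarith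
  have hden : 0 < x₀ - ℓ := by linarith
  have habs : |ℓ| = -ℓ := abs_of_nonpos hℓ
  -- `2 √(x₀-1) √(1+|ℓ|) ≤ (x₀ - 1) + (1 + |ℓ|) = x₀ - ℓ`
  have hamgm : 2 * Real.sqrt (x₀ - 1) * Real.sqrt (1 + |ℓ|) ≤ x₀ - ℓ := by
    have h := two_mul_le_add_sq (Real.sqrt (x₀ - 1)) (Real.sqrt (1 + |ℓ|))
    rw [Real.sq_sqrt hc.le, Real.sq_sqrt hu] at h
    linarith [habs]
  rw [mul_inv_le_iff₀ hden, one_div, ← div_eq_inv_mul]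
  rw [le_div_iff₀ (by positivity)]
  linarith

/-- **The Schur product is `< 1` for a large base point.** With `R₀ = C₀ = W K /(2√(x₀ − 1))`
and `x₀ > 1 + W² K² / 4`: `R₀ C₀ < 1`. -/
theorem schur_product_lt_one {W K x₀ : ℝ} (hx₀ : 1 + W ^ 2 * K ^ 2 / 4 < x₀) :
    (W * K / (2 * Real.sqrt (x₀ - 1))) * (W * K / (2 * Real.sqrt (x₀ - 1))) < 1 := by
  have hc : 0 < x₀ - 1 := by nlinarith [sq_nonneg (W * K)]
  have hs : 0 < Real.sqrt (x₀ - 1) := Real.sqrt_pos.2 hc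
  rw [div_mul_div_comm, div_lt_one (by positivity)]
  have h2 : (2 * Real.sqrt (x₀ - 1)) * (2 * Real.sqrt (x₀ - 1)) = 4 * (x₀ - 1) := by
    rw [mul_mul_mul_comm, Real.mul_self_sqrt hc.le]; ring
  rw [h2]
  nlinarith [sq_nonneg (W * K)]

/-- **Entry bound of the relative-bound matrix.** If `‖a_ij‖ ≤ K w_j` (first-order growth) with
`w_j = √(1 + |ℓ_j|)`, `ℓ_j ≤ 0`, and `d_j = (x₀ − ℓ_j)⁻¹` with `x₀ > 1`, then
`‖a_ij d_j‖ ≤ K / (2 √(x₀ − 1))`. -/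
theorem entry_bound_of_growth {a : 𝕜} {K ℓ x₀ : ℝ} (hK : 0 ≤ K) (hℓ : ℓ ≤ 0) (hx₀ : 1 < x₀)
    (ha : ‖a‖ ≤ K * Real.sqrt (1 + |ℓ|)) :
    ‖a * (((x₀ - ℓ)⁻¹ : ℝ) : 𝕜)‖ ≤ K / (2 * Real.sqrt (x₀ - 1)) := by
  have hden : 0 < x₀ - ℓ := by linarith
  rw [norm_mul, RCLike.norm_ofReal, abs_of_pos (inv_pos.2 hden)]
  calc ‖a‖ * (x₀ - ℓ)⁻¹ ≤ K * Real.sqrt (1 + |ℓ|) * (x₀ - ℓ)⁻¹ :=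
        mul_le_mul_of_nonneg_right ha (inv_nonneg.2 hden.le)
    _ = K * (Real.sqrt (1 + |ℓ|) * (x₀ - ℓ)⁻¹) := by ring
    _ ≤ K * (1 / (2 * Real.sqrt (x₀ - 1))) :=
        mul_le_mul_of_nonneg_left (weight_mul_resolvent_le hℓ hx₀) hK
    _ = K / (2 * Real.sqrt (x₀ - 1)) := by ring

end Summit.NavierStokesRegularity.FluidComputer.SkewCutGalerkinSchurSums
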